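/-
Copyright (c) 2026 the pub-hodgecm-mathlib formalisation cell (harness21).  Prover seat hodgecm-mathlib-K2E4-p09 (g2), Track B «K2-LIT» ∕ h413, ‹S› ROAD J, brick (β):
the road-J assembler `‹J3› → ‹(J♮)›` (dealt BY NAME K2E4-plan (g2) 2026-09-04T00:28:50Z (A)).  2026-09-04.
-/
import Summits.HodgeConjecture.HodgeConjecture.Theorems.K2E3SingularTransferDressValueAtCentreOfEP   -- ★ (α) p856151 (K2E4-p13): EP-exposed twin export
import Summits.HodgeConjecture.HodgeConjecture.Theorems.K2E3SingularTransferSignedLocalOfLocalGermValue  -- ★ p856015 (K2E4-p06): frame-light imports of (J♮)'s consumer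
import Summits.HodgeConjecture.HodgeConjecture.Theorems.K2E3CentralizerDockHaarPlumbing            -- ★ p856222 (K2E4-p13): (P0)–(P4)
import Literature.NumberTheory.Rogawski1990.LocalNormFibreBadFrame                       -- ★ `exists_badFrame_dock`
import Literature.NumberTheory.Rogawski1990.SingularLocalOrbitSeparation                 -- ★ `isClosed_conjClass_local_of_mul_sub_smul_eq_zero`, `localStableOrbitalIntegral_eq_sum_of_mul_sub_smul_eq_zero`
import Literature.NumberTheory.Rogawski1990.LocalStableClassesNonsplitScalarFrameKappa   -- ★ `finExplicitDelta_eq_neg_of_not_isConj_of_fst_eq_smul_one`, `finKappaAt_eq_iff_isConj_of_fst_eq_smul_one`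
import Literature.NumberTheory.Rogawski1990.LocalTransferCompactSideJunctionCM           -- ★ `exists_isCanonical_cmDatum_local_two`, `isHaarMeasure_map_fst_of_compactSpace`
import Literature.NumberTheory.Rogawski1990.LocalTransferUnmatchedLocus                  -- ★ `compactSpace_cmDatum_local_one_of_smul_eq`
import Literature.NumberTheory.Rogawski1990.ExplicitFactorRationalLocalisation           -- ★ `coe_coe_toLocal_toAdelic`, `algebraMap_localRing_injective`
import Literature.NumberTheory.Automorphic.LocalOrbitalMeasureRegular                    -- ★ `isMulRightInvariant_localEndoscopic`
import Literature.NumberTheory.Automorphic.LocalUnitaryGroupUnimodular                   -- ★ `isMulRightInvariant_cmDatum_local_three`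
import Literature.MeasureTheory.Group.RightInvariantIsHaar                               -- ★ `isHaarMeasure_of_isMulRightInvariant_of_ne_zero`
import Summits.HodgeConjecture.HodgeConjecture.Theorems.K2E4SingularPairEigenplane        -- ★ `aniso_local_iff_kottwitzSignLocal_eq_neg_one`
import Summits.HodgeConjecture.HodgeConjecture.Theorems.K2E3RoadJScalarPartnerClasses          -- ★? p856300 (this seat): the two classes at the scalar partner
import Summits.HodgeConjecture.HodgeConjecture.Theorems.K2E3GermConstantRegularHR               -- ★ p855717 (K2E4-p07): frame recipe (`νH v` Haar, `ε_H`, docks) and its imports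
import Summits.HodgeConjecture.HodgeConjecture.Theorems.K2E4SingularPairIsLocalNormPair          -- ★ `singularPairIsLocalNormPair`
import Literature.NumberTheory.Rogawski1990.TamagawaSingularKappaBlockTransport                 -- ★ `not_isRegularElt_of_charpoly_eq_sq_mul`
import HarnessLib

/-!
# ‹S› ROAD J, brick (β): THE ROAD-J ASSEMBLER — (J♮) `sig_K2E3SingularTransferLocalGermValue` FROM ‹J3› (Rogawski Prop. 8.2.1 (a) ⟸ Prop. 8.1.3, p. 117 «d(j) independent of j»)

Cell `pub/hodgecm-mathlib` (D-0151), Track B «K2-LIT», crux H413 = `stmt-HodgeConjecture-24833`; ‹S› = `sig_K2E3SingularTransferSigned` (E3-owned, U3b), ROAD J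
(K2E3-plan BATCH #3; K2E4-p06 (g2) 2026-09-04T00:13:34Z cut; K2E4-plan (g2) 00:23:09Z ∕ 00:28:50Z (A) ∕ 00:36:49Z ∕ 00:39:25Z).  Prover seat hodgecm-mathlib-K2E4-p09 (g2).
THEOREMS ONLY (two ring-generic private matrix identities + one theorem; no `def`, no instance, no notation, no `sorry`); lane `--supports stmt-HodgeConjecture-24833 --as helper`.

**`localGermValue_of_rankOneMass : ‹J3 v2› → ‹(J♮)›`** — hypothesis = the text of ‹J3› «compatible-measure Euler–Poincaré identity, rank one, ∃-form»
(`K2/K2E4-p14/g2/sig_K2E3CompatibleMeasureEPIdentityRankOne.cand.v2.K2E4-p14-g2.lean` 30b996756c6578c4, K2E3-r01 box PASS, hosted by K2E3-plan in U3b), pasted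
programmatically; conclusion = the text of (J♮) (`K2/K2E4-p06/g2/sig_K2E3SingularTransferLocalGermValue.cand.K2E4-p06-g2.lean` 45a4db33ca6420d0) VERBATIM.  (J♮): at a
NON-SPLIT finite place `v`, for the rational κ-singular pair `γ_H = (e₁·1₂, e₂) → γ₀`, there is a REAL `c ≠ 0`, NEGATIVE iff the `e₁`-eigenplane of `(γ₀)_v` is anisotropic, such
that every `f ∈ C_c^∞(G′_v)` has a smooth `f^H`, a `Δ‴_v`-transfer of `f` near `(γ_H)_v`, with `Δ‴_v((γ_H)_v, (γ₀)_v)·Φ^st_{|ω|}((γ₀)_v, f) = c·f^H((γ_H)_v)`.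
PROOF (Rogawski pp. 117–119 «with values»; plan (b1)–(b6) of K2E4-p06∕p14): (B) LOCAL→GLOBAL BRIDGE — σ-algebras are Borel, `ν_{H,v} ≠ 0` (an admissible canonical family
charges a `G`-regular class) hence Haar, and `ν_{H,v}`, `ν_{G,v}` become the `v`-components of global Haar families (`Function.update` of `haar`); (b1) centre `ε_H`, central
dock `(ε, y, θ)`, swap `W`, bad frame, closed orbit of `ε`; the singular guard of every match of `ε_H` (★ `singularPairIsLocalNormPair`); (P1) `θ_*ν_H = aθ • t^ω(ε)`; the EP
datum and ‹J3›'s `(f₂, r)`; the CONSTANT `c := ±aθ` by the class of `(γ₀)_v`, SIGN LAW ★ `kottwitzSignLocal_eq_neg_one_iff_not_isConj_dock` + ★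
`aniso_local_iff_kottwitzSignLocal_eq_neg_one`; per `f`: ★ (α) gives `ε′`, `f^H := φ^H` and `φ^H(ε_H) = Δ‴(ε_H,ε)·Φ(ε, f; ν_G∕θ_*ν_H) + Δ‴(ε_H,ε′)·(∫ f(yε′y⁻¹) dν_G)·(−r)`;
(P2)(P3)(P4) read the two terms as `aθ⁻¹·Φ_{|ω|}(⟦ε⟧, f)`, `t^ω(ε′)(Z(ε′))·Φ_{|ω|}(⟦ε′⟧, f)` (`Z(ε′)` compact, ★ A1); (b2) `Δ‴(ε_H, ε′) = −Δ‴(ε_H, ε)`; ‹J3› kills `r`;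
(b5) `Φ^st((γ₀)_v, f) = Φ(⟦ε⟧) + Φ(⟦ε′⟧)` (★ A7), `Δ‴((γ_H)_v, (γ₀)_v) = ±Δ‴(ε_H, ε)` (★ A5 + ★ `finExplicitDelta_conj_right_all`); `field_simp; linear_combination`.
HONEST LABEL: HC_CM is proved only modulo the 7 printed citations (2 remaining named inputs: hLiu418 = `stmt-HodgeConjecture-24832`, h413 = `stmt-HodgeConjecture-24833`)
until rung 0 closes; this file pays (J♮) only TOGETHER with ‹J3› (un-★: R3 «rank-one mass», K2E3's deal) — an implication between hosted letters, count-neutral.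
-/

set_option autoImplicit false
set_option linter.dupNamespace false

noncomputable section

open Set Filter Topology MeasureTheory MeasureTheory.Measure NumberField IsDedekindDomain
open _root_.Matrix hiding mem_unitaryGroup_iff unitaryGroup
open Literature.NumberTheory.Automorphic Literature.NumberTheory.GaloisRepresentations Literature.MeasureTheory.Group
open Literature.NumberTheory.Automorphic.UnitaryGroup hiding hermForm hermForm_apply hermForm_mulVec
open Literature.NumberTheory.Rogawski1990 Literature.NumberTheory.Weil1982.UnitaryFinTopForm
open Literature.AlgebraicGeometry.ShimuraVarieties (unitaryGroup hermForm)
open Summit.HodgeConjecture.HodgeConjecture.Cruxes.H413.K2E3SingularTransferDressValueAtCentreOfEP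
open Summit.HodgeConjecture.HodgeConjecture.Cruxes.H413.K2E3CentralizerDockHaarPlumbing
open scoped MatrixGroups NNReal ENNReal

namespace Summit.HodgeConjecture.HodgeConjecture.Cruxes.H413.K2E3SingularTransferLocalGermValueOfRoadJ

/-- `diag(a, u, a)` is killed by `(X − a)(X − u)` (ring-generic, so that no `3 × 3` computation runs over `∏_w L_w`). [cite: Rogawski1990, §3.1 p. 19] -/
private theorem diag_sub_smul_mul_sub_smul_eq_zero {R : Type*} [CommRing R] (a u : R) :
    ((!![a, 0, 0; 0, u, 0; 0, 0, a] : Matrix (Fin 3) (Fin 3) R) - a • (1 : Matrix (Fin 3) (Fin 3) R)) * (!![a, 0, 0; 0, u, 0; 0, 0, a] - u • (1 : Matrix (Fin 3) (Fin 3) R)) = 0 := by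
  ext i j
  fin_cases i <;> fin_cases j <;> simp [Matrix.mul_apply, Fin.sum_univ_three, Matrix.smul_apply]

/-- The swap `(e₂ e₃)` squares to `1` (ring-generic). [folklore] -/
private theorem swap_mul_swap_eq_one {R : Type*} [CommRing R] :
    (!![(1 : R), 0, 0; 0, 0, 1; 0, 1, 0] : Matrix (Fin 3) (Fin 3) R) * !![(1 : R), 0, 0; 0, 0, 1; 0, 1, 0] = 1 := by
  ext i j
  fin_cases i <;> fin_cases j <;> simp [Matrix.mul_apply, Fin.sum_univ_three]

open scoped Classical in
/-- **(β) THE ROAD-J ASSEMBLER: ‹J3› → (J♮).**  Hypothesis: the text of ‹J3› v2 (`sig_K2E3CompatibleMeasureEPIdentityRankOne`, ∃-form: an Euler–Poincaré datum `(f₂, r)` for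
`((pr₁)_*ν_H, m₂)` with the compatible-measure identity `r · aθ · t^ω_v(ε′)(Z(ε′)) = 1` for every framed matched second class `ε′` and every dock scalar `aθ`).  Conclusion: the
text of (J♮) `sig_K2E3SingularTransferLocalGermValue` VERBATIM.  See the module docstring for the proof.
[cite: Rogawski1990, §8.2 Prop. 8.2.1 (a)(d) pp. 117–122; §8.1 Prop. 8.1.3 pp. 115–117, (8.1.1)–(8.1.2) p. 117; §4.3 (4.3.1) p. 43; §1.7 p. 6] [cite: Kottwitz1988, §1, §2 Theorem 2]
[cite: LanglandsShelstad1990Descent, Thm. 2.3.A, §2.4] -/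
theorem localGermValue_of_rankOneMass
    (hJ3 :
      ∀ (L : Type) [Field L] [NumberField L] [IsCMField L] (H' : Matrix (Fin 3) (Fin 3) L) (μ : HeckeCharacter L)
        [∀ v : HeightOneSpectrum (𝓞 ↥(maximalRealSubfield L)),
          MeasurableSpace ((UnitaryGroup.cmDatum L 2 (Matrix.of fun i j : Fin 2 => if i.val + j.val + 1 = 2 then (1 : L) else 0)).Local v ×
            (UnitaryGroup.cmDatum L 1 (Matrix.of fun i j : Fin 1 => if i.val + j.val + 1 = 1 then (1 : L) else 0)).Local v)]
        [∀ v : HeightOneSpectrum (𝓞 ↥(maximalRealSubfield L)),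
          BorelSpace ((UnitaryGroup.cmDatum L 2 (Matrix.of fun i j : Fin 2 => if i.val + j.val + 1 = 2 then (1 : L) else 0)).Local v ×
            (UnitaryGroup.cmDatum L 1 (Matrix.of fun i j : Fin 1 => if i.val + j.val + 1 = 1 then (1 : L) else 0)).Local v)]
        [∀ v : HeightOneSpectrum (𝓞 ↥(maximalRealSubfield L)), MeasurableSpace ((UnitaryGroup.cmDatum L 3 H').Local v)]
        [∀ v : HeightOneSpectrum (𝓞 ↥(maximalRealSubfield L)), BorelSpace ((UnitaryGroup.cmDatum L 3 H').Local v)]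
        (νH : ∀ v : HeightOneSpectrum (𝓞 ↥(maximalRealSubfield L)),
          Measure ((UnitaryGroup.cmDatum L 2 (Matrix.of fun i j : Fin 2 => if i.val + j.val + 1 = 2 then (1 : L) else 0)).Local v ×
            (UnitaryGroup.cmDatum L 1 (Matrix.of fun i j : Fin 1 => if i.val + j.val + 1 = 1 then (1 : L) else 0)).Local v))
        (νG : ∀ v : HeightOneSpectrum (𝓞 ↥(maximalRealSubfield L)), Measure ((UnitaryGroup.cmDatum L 3 H').Local v))
        [∀ v, (νH v).IsHaarMeasure] [∀ v, (νH v).IsMulRightInvariant] [∀ v, (νG v).IsHaarMeasure] [∀ v, (νG v).IsMulRightInvariant],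
        μ.IsUnitary →
        (∀ x : ideleGroup ↥(maximalRealSubfield L), μ (AdeleRing.ideleBaseChange (↥(maximalRealSubfield L)) L x) = quadraticHeckeCharCM L x) →
        (H'.map (cmConjRingHom L)).transpose = H' →
        (∀ x : Fin 3 → L, Literature.AlgebraicGeometry.ShimuraVarieties.hermForm (cmConjRingHom L) H' x x = 0 → x = 0) →
        ∀ (v : HeightOneSpectrum (𝓞 ↥(maximalRealSubfield L))), Subsingleton (UnitaryGroup.PlacesOver L v) →
        ∀ [_iH : ∀ a : ((UnitaryGroup.cmDatum L 2 (Matrix.of fun i j : Fin 2 => if i.val + j.val + 1 = 2 then (1 : L) else 0)).Local v × (UnitaryGroup.cmDatum L 1 (Matrix.of fun i j : Fin 1 => if i.val + j.val + 1 = 1 then (1 : L) else 0)).Local v),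
            MeasurableSpace (((UnitaryGroup.cmDatum L 2 (Matrix.of fun i j : Fin 2 => if i.val + j.val + 1 = 2 then (1 : L) else 0)).Local v × (UnitaryGroup.cmDatum L 1 (Matrix.of fun i j : Fin 1 => if i.val + j.val + 1 = 1 then (1 : L) else 0)).Local v) ⧸
              Subgroup.centralizer ({a} : Set ((UnitaryGroup.cmDatum L 2 (Matrix.of fun i j : Fin 2 => if i.val + j.val + 1 = 2 then (1 : L) else 0)).Local v × (UnitaryGroup.cmDatum L 1 (Matrix.of fun i j : Fin 1 => if i.val + j.val + 1 = 1 then (1 : L) else 0)).Local v)))]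
          [_bH : ∀ a : ((UnitaryGroup.cmDatum L 2 (Matrix.of fun i j : Fin 2 => if i.val + j.val + 1 = 2 then (1 : L) else 0)).Local v × (UnitaryGroup.cmDatum L 1 (Matrix.of fun i j : Fin 1 => if i.val + j.val + 1 = 1 then (1 : L) else 0)).Local v),
            BorelSpace (((UnitaryGroup.cmDatum L 2 (Matrix.of fun i j : Fin 2 => if i.val + j.val + 1 = 2 then (1 : L) else 0)).Local v × (UnitaryGroup.cmDatum L 1 (Matrix.of fun i j : Fin 1 => if i.val + j.val + 1 = 1 then (1 : L) else 0)).Local v) ⧸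
              Subgroup.centralizer ({a} : Set ((UnitaryGroup.cmDatum L 2 (Matrix.of fun i j : Fin 2 => if i.val + j.val + 1 = 2 then (1 : L) else 0)).Local v × (UnitaryGroup.cmDatum L 1 (Matrix.of fun i j : Fin 1 => if i.val + j.val + 1 = 1 then (1 : L) else 0)).Local v)))]
          [_iG : ∀ γ : ((UnitaryGroup.cmDatum L 3 H').Local v), MeasurableSpace (((UnitaryGroup.cmDatum L 3 H').Local v) ⧸ Subgroup.centralizer ({γ} : Set ((UnitaryGroup.cmDatum L 3 H').Local v)))]
          [_bG : ∀ γ : ((UnitaryGroup.cmDatum L 3 H').Local v), BorelSpace (((UnitaryGroup.cmDatum L 3 H').Local v) ⧸ Subgroup.centralizer ({γ} : Set ((UnitaryGroup.cmDatum L 3 H').Local v)))]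
          (mH : OrbitalMeasureFamily ((UnitaryGroup.cmDatum L 2 (Matrix.of fun i j : Fin 2 => if i.val + j.val + 1 = 2 then (1 : L) else 0)).Local v × (UnitaryGroup.cmDatum L 1 (Matrix.of fun i j : Fin 1 => if i.val + j.val + 1 = 1 then (1 : L) else 0)).Local v))
          (mG : OrbitalMeasureFamily ((UnitaryGroup.cmDatum L 3 H').Local v)),
        mH.IsCanonical (IsLocalGRegular L v) (νH v) → mG.IsCanonical (fun γ => IsRegularElt (γ.val : GL (Fin 3) (UnitaryGroup.LocalRing L v))) (νG v) →
        ∀ (εH : ((UnitaryGroup.cmDatum L 2 (Matrix.of fun i j : Fin 2 => if i.val + j.val + 1 = 2 then (1 : L) else 0)).Local v × (UnitaryGroup.cmDatum L 1 (Matrix.of fun i j : Fin 1 => if i.val + j.val + 1 = 1 then (1 : L) else 0)).Local v)) (a : (UnitaryGroup.LocalRing L v)),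
          (εH.1.val.val : Matrix (Fin 2) (Fin 2) (UnitaryGroup.LocalRing L v)) = a • (1 : Matrix (Fin 2) (Fin 2) (UnitaryGroup.LocalRing L v)) →
          (εH.2.val.val : Matrix (Fin 1) (Fin 1) (UnitaryGroup.LocalRing L v)) 0 0 ≠ a →
          -- the central dock (★ `exists_centralDock_of_fst_eq_smul_one`)
          ∀ (ε : ((UnitaryGroup.cmDatum L 3 H').Local v)) (y : GL (Fin 3) (UnitaryGroup.LocalRing L v)) (θ : ((UnitaryGroup.cmDatum L 2 (Matrix.of fun i j : Fin 2 => if i.val + j.val + 1 = 2 then (1 : L) else 0)).Local v × (UnitaryGroup.cmDatum L 1 (Matrix.of fun i j : Fin 1 => if i.val + j.val + 1 = 1 then (1 : L) else 0)).Local v) ≃ₜ* ↥(Subgroup.centralizer ({ε} : Set ((UnitaryGroup.cmDatum L 3 H').Local v)))),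
          (θ εH).1 = ε →
          (∀ z : ((UnitaryGroup.cmDatum L 2 (Matrix.of fun i j : Fin 2 => if i.val + j.val + 1 = 2 then (1 : L) else 0)).Local v × (UnitaryGroup.cmDatum L 1 (Matrix.of fun i j : Fin 1 => if i.val + j.val + 1 = 1 then (1 : L) else 0)).Local v), (((θ z).1).val : GL (Fin 3) (UnitaryGroup.LocalRing L v)) = y * ((endoEmbLocal L v z).val : GL (Fin 3) (UnitaryGroup.LocalRing L v)) * y⁻¹) →
          -- the bad frame on the dock (★ `exists_badFrame_dock`)
          ∀ (W : GL (Fin 3) (UnitaryGroup.LocalRing L v)), W.val = !![(1 : UnitaryGroup.LocalRing L v), 0, 0; 0, 0, 1; 0, 1, 0] →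
          ∀ (G₁ G₁' : Matrix (Fin 2) (Fin 2) (UnitaryGroup.LocalRing L v)) (G₂ G₂' : Matrix (Fin 1) (Fin 1) (UnitaryGroup.LocalRing L v)) (P' : GL (Fin (2 + 1)) (UnitaryGroup.LocalRing L v)),
          twistGram (UnitaryGroup.conjLocal L (IsCMField.complexConj L) v) ((UnitaryGroup.adelicForm L 3 H').map (UnitaryGroup.adeleToLocal L v)) (y * W).val = UnitaryGroup.finSum 2 1 G₁ G₂ →
          twistGram (UnitaryGroup.conjLocal L (IsCMField.complexConj L) v) ((UnitaryGroup.adelicForm L 3 H').map (UnitaryGroup.adeleToLocal L v)) P'.val = UnitaryGroup.finSum 2 1 G₁' G₂' →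
          (¬ ∃ z : UnitaryGroup.LocalRing L v, IsUnit z ∧ G₁'.det = G₁.det * (UnitaryGroup.conjLocal L (IsCMField.complexConj L) v z * z)) →
          -- the orbit of the dock point `ε` is closed (`(ε − a)(ε − u) = 0` with `a − u` a unit: ★ `isClosed_conjClass_local_of_mul_sub_smul_eq_zero`)
          IsClosed {g : ((UnitaryGroup.cmDatum L 3 H').Local v) | ∃ x : ((UnitaryGroup.cmDatum L 3 H').Local v), x * ε * x⁻¹ = g} →
          -- an Euler–Poincaré datum `(ν₂, m₂, f₂, r)` on `U(Φ₂)_v` (★ J2♯ `rankOneEulerPoincareNonsplit_withCentralValue`'s inputs and conclusion fields, BOUND): Borel structures on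
          -- `U(Φ₂)_v` and its orbit spaces, a Haar measure `ν₂ = (pr₁)_* ν_H`, a family `m₂` canonical for the regular classes and `ν₂`, `f₂ ∈ C_c^∞(U(Φ₂)_v)` with orbital integrals
          -- `1 ∕ 0` on the regular elliptic ∕ split classes (w.r.t. `m₂`), and the scalar value `f₂(b·1) = −r`
          ∀ [_iU₂ : MeasurableSpace ((UnitaryGroup.cmDatum L 2 (Matrix.of fun i j : Fin 2 => if i.val + j.val + 1 = 2 then (1 : L) else 0)).Local v)] [_bU₂ : BorelSpace ((UnitaryGroup.cmDatum L 2 (Matrix.of fun i j : Fin 2 => if i.val + j.val + 1 = 2 then (1 : L) else 0)).Local v)]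
            [_iZ₂ : ∀ γ : ((UnitaryGroup.cmDatum L 2 (Matrix.of fun i j : Fin 2 => if i.val + j.val + 1 = 2 then (1 : L) else 0)).Local v), MeasurableSpace (((UnitaryGroup.cmDatum L 2 (Matrix.of fun i j : Fin 2 => if i.val + j.val + 1 = 2 then (1 : L) else 0)).Local v) ⧸ Subgroup.centralizer ({γ} : Set ((UnitaryGroup.cmDatum L 2 (Matrix.of fun i j : Fin 2 => if i.val + j.val + 1 = 2 then (1 : L) else 0)).Local v)))]
            [_bZ₂ : ∀ γ : ((UnitaryGroup.cmDatum L 2 (Matrix.of fun i j : Fin 2 => if i.val + j.val + 1 = 2 then (1 : L) else 0)).Local v), BorelSpace (((UnitaryGroup.cmDatum L 2 (Matrix.of fun i j : Fin 2 => if i.val + j.val + 1 = 2 then (1 : L) else 0)).Local v) ⧸ Subgroup.centralizer ({γ} : Set ((UnitaryGroup.cmDatum L 2 (Matrix.of fun i j : Fin 2 => if i.val + j.val + 1 = 2 then (1 : L) else 0)).Local v)))]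
            (ν₂ : Measure ((UnitaryGroup.cmDatum L 2 (Matrix.of fun i j : Fin 2 => if i.val + j.val + 1 = 2 then (1 : L) else 0)).Local v)) [ν₂.IsHaarMeasure] [ν₂.IsMulRightInvariant]
            (m₂ : OrbitalMeasureFamily ((UnitaryGroup.cmDatum L 2 (Matrix.of fun i j : Fin 2 => if i.val + j.val + 1 = 2 then (1 : L) else 0)).Local v)),
          Measure.map (Prod.fst : (((UnitaryGroup.cmDatum L 2 (Matrix.of fun i j : Fin 2 => if i.val + j.val + 1 = 2 then (1 : L) else 0)).Local v) × ((UnitaryGroup.cmDatum L 1 (Matrix.of fun i j : Fin 1 => if i.val + j.val + 1 = 1 then (1 : L) else 0)).Local v)) → ((UnitaryGroup.cmDatum L 2 (Matrix.of fun i j : Fin 2 => if i.val + j.val + 1 = 2 then (1 : L) else 0)).Local v)) (νH v) = ν₂ →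
          m₂.IsCanonical (fun γ => IsRegularElt (γ.val : GL (Fin 2) (UnitaryGroup.LocalRing L v))) ν₂ →
          -- ‹J3› (∃-form): an Euler–Poincaré datum `(f₂, r)` on `U(Φ₂)_v` for `(ν₂, m₂)` — ★ J2♯'s three conclusion fields — TOGETHER WITH the compatible-measure identity
          ∃ (f₂ : ((UnitaryGroup.cmDatum L 2 (Matrix.of fun i j : Fin 2 => if i.val + j.val + 1 = 2 then (1 : L) else 0)).Local v) → ℂ) (r : ℝ), IsLocSmooth f₂ ∧
          (∀ γ : ((UnitaryGroup.cmDatum L 2 (Matrix.of fun i j : Fin 2 => if i.val + j.val + 1 = 2 then (1 : L) else 0)).Local v), IsRegularElt (γ.val : GL (Fin 2) (UnitaryGroup.LocalRing L v)) → CompactSpace (Subgroup.centralizer ({γ} : Set ((UnitaryGroup.cmDatum L 2 (Matrix.of fun i j : Fin 2 => if i.val + j.val + 1 = 2 then (1 : L) else 0)).Local v))) →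
              classOrbitalIntegral m₂ f₂ (ConjClasses.mk γ) = 1) ∧
          (∀ γ : ((UnitaryGroup.cmDatum L 2 (Matrix.of fun i j : Fin 2 => if i.val + j.val + 1 = 2 then (1 : L) else 0)).Local v), IsRegularElt (γ.val : GL (Fin 2) (UnitaryGroup.LocalRing L v)) → ¬ CompactSpace (Subgroup.centralizer ({γ} : Set ((UnitaryGroup.cmDatum L 2 (Matrix.of fun i j : Fin 2 => if i.val + j.val + 1 = 2 then (1 : L) else 0)).Local v))) →
              classOrbitalIntegral m₂ f₂ (ConjClasses.mk γ) = 0) ∧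
          (∀ (z : ((UnitaryGroup.cmDatum L 2 (Matrix.of fun i j : Fin 2 => if i.val + j.val + 1 = 2 then (1 : L) else 0)).Local v)) (b : UnitaryGroup.LocalRing L v),
              ((z.val : GL (Fin 2) (UnitaryGroup.LocalRing L v)).val : Matrix (Fin 2) (Fin 2) (UnitaryGroup.LocalRing L v)) = b • (1 : Matrix (Fin 2) (Fin 2) (UnitaryGroup.LocalRing L v)) →
              f₂ z = -(r : ℂ)) ∧
            -- the identity: for every framed, matched second class `ε′` ((α)'s outputs) and every Haar comparison scalar `aθ` on `Z(ε)` ((β)'s (b3))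
            ∀ (ε' : ((UnitaryGroup.cmDatum L 3 H').Local v)),
              (ε'.val.val : Matrix (Fin 3) (Fin 3) (UnitaryGroup.LocalRing L v)) * P'.val =
                P'.val * UnitaryGroup.finSum 2 1 (a • (1 : Matrix (Fin 2) (Fin 2) (UnitaryGroup.LocalRing L v))) (εH.2.val.val : Matrix (Fin 1) (Fin 1) (UnitaryGroup.LocalRing L v)) →
              IsLocalNormPair L H' v εH ε' →
            ∀ (aθ : ℝ≥0),
              Measure.map (⇑θ) (νH v) = aθ • Literature.NumberTheory.Weil1982.UnitaryFinTopForm.finTamagawaPartner L 3 H' v ε →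
              r * (aθ : ℝ) * ((Literature.NumberTheory.Weil1982.UnitaryFinTopForm.finTamagawaPartner L 3 H' v ε') Set.univ).toReal = 1) :
    ∀ (L : Type) [Field L] [NumberField L] [IsCMField L] (H' : Matrix (Fin 3) (Fin 3) L),
      (H'.map (cmConjRingHom L)).transpose = H' →
      (∀ x : Fin 3 → L, hermForm (cmConjRingHom L) H' x x = 0 → x = 0) →
    ∀ (v : HeightOneSpectrum (𝓞 ↥(maximalRealSubfield L)))
      [MeasurableSpace ((UnitaryGroup.cmDatum L 2 (Matrix.of fun i j : Fin 2 => if i.val + j.val + 1 = 2 then (1 : L) else 0)).Local v × (UnitaryGroup.cmDatum L 1 (Matrix.of fun i j : Fin 1 => if i.val + j.val + 1 = 1 then (1 : L) else 0)).Local v)] [BorelSpace ((UnitaryGroup.cmDatum L 2 (Matrix.of fun i j : Fin 2 => if i.val + j.val + 1 = 2 then (1 : L) else 0)).Local v × (UnitaryGroup.cmDatum L 1 (Matrix.of fun i j : Fin 1 => if i.val + j.val + 1 = 1 then (1 : L) else 0)).Local v)]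
      [∀ a : (UnitaryGroup.cmDatum L 2 (Matrix.of fun i j : Fin 2 => if i.val + j.val + 1 = 2 then (1 : L) else 0)).Local v × (UnitaryGroup.cmDatum L 1 (Matrix.of fun i j : Fin 1 => if i.val + j.val + 1 = 1 then (1 : L) else 0)).Local v,
        MeasurableSpace (((UnitaryGroup.cmDatum L 2 (Matrix.of fun i j : Fin 2 => if i.val + j.val + 1 = 2 then (1 : L) else 0)).Local v × (UnitaryGroup.cmDatum L 1 (Matrix.of fun i j : Fin 1 => if i.val + j.val + 1 = 1 then (1 : L) else 0)).Local v) ⧸ Subgroup.centralizer ({a} : Set ((UnitaryGroup.cmDatum L 2 (Matrix.of fun i j : Fin 2 => if i.val + j.val + 1 = 2 then (1 : L) else 0)).Local v × (UnitaryGroup.cmDatum L 1 (Matrix.of fun i j : Fin 1 => if i.val + j.val + 1 = 1 then (1 : L) else 0)).Local v)))]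
      [∀ a : (UnitaryGroup.cmDatum L 2 (Matrix.of fun i j : Fin 2 => if i.val + j.val + 1 = 2 then (1 : L) else 0)).Local v × (UnitaryGroup.cmDatum L 1 (Matrix.of fun i j : Fin 1 => if i.val + j.val + 1 = 1 then (1 : L) else 0)).Local v,
        BorelSpace (((UnitaryGroup.cmDatum L 2 (Matrix.of fun i j : Fin 2 => if i.val + j.val + 1 = 2 then (1 : L) else 0)).Local v × (UnitaryGroup.cmDatum L 1 (Matrix.of fun i j : Fin 1 => if i.val + j.val + 1 = 1 then (1 : L) else 0)).Local v) ⧸ Subgroup.centralizer ({a} : Set ((UnitaryGroup.cmDatum L 2 (Matrix.of fun i j : Fin 2 => if i.val + j.val + 1 = 2 then (1 : L) else 0)).Local v × (UnitaryGroup.cmDatum L 1 (Matrix.of fun i j : Fin 1 => if i.val + j.val + 1 = 1 then (1 : L) else 0)).Local v)))]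
      [MeasurableSpace ((UnitaryGroup.cmDatum L 3 H').Local v)] [BorelSpace ((UnitaryGroup.cmDatum L 3 H').Local v)]
      [∀ γ : (UnitaryGroup.cmDatum L 3 H').Local v, MeasurableSpace ((UnitaryGroup.cmDatum L 3 H').Local v ⧸ Subgroup.centralizer ({γ} : Set ((UnitaryGroup.cmDatum L 3 H').Local v)))]
      [∀ γ : (UnitaryGroup.cmDatum L 3 H').Local v, BorelSpace ((UnitaryGroup.cmDatum L 3 H').Local v ⧸ Subgroup.centralizer ({γ} : Set ((UnitaryGroup.cmDatum L 3 H').Local v)))]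
      (νHv : Measure ((UnitaryGroup.cmDatum L 2 (Matrix.of fun i j : Fin 2 => if i.val + j.val + 1 = 2 then (1 : L) else 0)).Local v × (UnitaryGroup.cmDatum L 1 (Matrix.of fun i j : Fin 1 => if i.val + j.val + 1 = 1 then (1 : L) else 0)).Local v)) (νGv : Measure ((UnitaryGroup.cmDatum L 3 H').Local v))
      [IsFiniteMeasureOnCompacts νHv] [νHv.IsMulRightInvariant] [νGv.IsHaarMeasure] [νGv.IsMulRightInvariant]
      (Δv : LocalTransferFactor L H' v)
      (mHv : OrbitalMeasureFamily ((UnitaryGroup.cmDatum L 2 (Matrix.of fun i j : Fin 2 => if i.val + j.val + 1 = 2 then (1 : L) else 0)).Local v × (UnitaryGroup.cmDatum L 1 (Matrix.of fun i j : Fin 1 => if i.val + j.val + 1 = 1 then (1 : L) else 0)).Local v)) (mGv : OrbitalMeasureFamily ((UnitaryGroup.cmDatum L 3 H').Local v)),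
      IsLocalTransferDatum L H' v Δv mHv mGv →
      mHv.IsCanonical (IsLocalGRegular L v) νHv →
      mGv.IsCanonical (fun γ : (UnitaryGroup.cmDatum L 3 H').Local v => IsRegularElt (γ.val : GL (Fin 3) (UnitaryGroup.LocalRing L v))) νGv →
      Subsingleton (UnitaryGroup.PlacesOver L v) →
    ∀ (μ : Literature.NumberTheory.GaloisRepresentations.HeckeCharacter L), μ.IsUnitary →
      (∀ x : Literature.NumberTheory.GaloisRepresentations.ideleGroup ↥(maximalRealSubfield L),
        μ (AdeleRing.ideleBaseChange (↥(maximalRealSubfield L)) L x) = quadraticHeckeCharCM L x) →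
      Δv = finExplicitCollection L H' μ (finExplicitDelta_conj_left_all L H' μ) (finExplicitDelta_conj_right_all L H' μ) v →
    ∀ (mGs₀v : OrbitalMeasureFamily ((UnitaryGroup.cmDatum L 3 H').Local v)),
      mGs₀v.IsQuotientOf (fun x : (UnitaryGroup.cmDatum L 3 H').Local v => ∃ γ₀ : (UnitaryGroup.cmDatum L 3 H').Rational, ¬ IsRegularElt (γ₀.val : GL (Fin 3) L) ∧
          Corresponds (UnitaryGroup.conjLocal L (IsCMField.complexConj L) v)
            ((UnitaryGroup.adelicForm L 3 H').map (UnitaryGroup.adeleToLocal L v))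
            ((UnitaryGroup.adelicForm L 3 H').map (UnitaryGroup.adeleToLocal L v))
            ((UnitaryGroup.cmDatum L 3 H').toLocal v ((UnitaryGroup.cmDatum L 3 H').toAdelic γ₀)) x) νGv (Literature.NumberTheory.Weil1982.UnitaryFinTopForm.finTamagawaPartner L 3 H' v) →
    ∀ (γ₀ : (UnitaryGroup.cmDatum L 3 H').Rational) (e₁ e₂ : L), e₁ ≠ e₂ →
      ((((γ₀ : unitaryGroup (cmConjRingHom L) H').val : GL (Fin 3) L) : Matrix (Fin 3) (Fin 3) L) - e₁ • (1 : Matrix (Fin 3) (Fin 3) L)) *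
        ((((γ₀ : unitaryGroup (cmConjRingHom L) H').val : GL (Fin 3) L) : Matrix (Fin 3) (Fin 3) L) - e₂ • (1 : Matrix (Fin 3) (Fin 3) L)) = 0 →
      (¬ ∃ ζ : L, (((γ₀ : unitaryGroup (cmConjRingHom L) H').val : GL (Fin 3) L) : Matrix (Fin 3) (Fin 3) L) = ζ • (1 : Matrix (Fin 3) (Fin 3) L)) →
      (((γ₀ : unitaryGroup (cmConjRingHom L) H').val : GL (Fin 3) L) : Matrix (Fin 3) (Fin 3) L).charpoly =
        (Polynomial.X - Polynomial.C e₁) ^ 2 * (Polynomial.X - Polynomial.C e₂) →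
    ∀ (γH : (UnitaryGroup.cmDatum L 2 (Matrix.of fun i j : Fin 2 => if i.val + j.val + 1 = 2 then (1 : L) else 0)).Rational × (UnitaryGroup.cmDatum L 1 (Matrix.of fun i j : Fin 1 => if i.val + j.val + 1 = 1 then (1 : L) else 0)).Rational),
      (((γH.1 : unitaryGroup (cmConjRingHom L) (Matrix.of fun i j : Fin 2 => if i.val + j.val + 1 = 2 then (1 : L) else 0)).val : GL (Fin 2) L) : Matrix (Fin 2) (Fin 2) L) =
        e₁ • (1 : Matrix (Fin 2) (Fin 2) L) →
      (((γH.2 : unitaryGroup (cmConjRingHom L) (Matrix.of fun i j : Fin 1 => if i.val + j.val + 1 = 1 then (1 : L) else 0)).val : GL (Fin 1) L) : Matrix (Fin 1) (Fin 1) L) 0 0 = e₂ →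
    ∃ c : ℝ, c ≠ 0 ∧ (c < 0 ↔ (∀ x : Fin 3 → UnitaryGroup.LocalRing L v,
            Matrix.mulVec (((((γ₀ : unitaryGroup (cmConjRingHom L) H').val : GL (Fin 3) L) : Matrix (Fin 3) (Fin 3) L)).map (algebraMap L (UnitaryGroup.LocalRing L v)) -
                algebraMap L (UnitaryGroup.LocalRing L v) e₁ • (1 : Matrix (Fin 3) (Fin 3) (UnitaryGroup.LocalRing L v))) x = 0 →
            (∑ i, ∑ j, UnitaryGroup.conjLocal L (IsCMField.complexConj L) v (x i) * algebraMap L (UnitaryGroup.LocalRing L v) (H' i j) * x j) = 0 →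
            x = 0)) ∧
      ∀ (f : (UnitaryGroup.cmDatum L 3 H').Local v → ℂ), IsLocSmooth f →
        ∃ fH : (UnitaryGroup.cmDatum L 2 (Matrix.of fun i j : Fin 2 => if i.val + j.val + 1 = 2 then (1 : L) else 0)).Local v × (UnitaryGroup.cmDatum L 1 (Matrix.of fun i j : Fin 1 => if i.val + j.val + 1 = 1 then (1 : L) else 0)).Local v → ℂ, IsLocSmooth fH ∧
          (∀ᶠ γ in 𝓝[{γ : (UnitaryGroup.cmDatum L 2 (Matrix.of fun i j : Fin 2 => if i.val + j.val + 1 = 2 then (1 : L) else 0)).Local v × (UnitaryGroup.cmDatum L 1 (Matrix.of fun i j : Fin 1 => if i.val + j.val + 1 = 1 then (1 : L) else 0)).Local v | IsLocalGRegular L v γ}]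
          ((UnitaryGroup.cmDatum L 2 (Matrix.of fun i j : Fin 2 => if i.val + j.val + 1 = 2 then (1 : L) else 0)).toLocal v ((UnitaryGroup.cmDatum L 2 (Matrix.of fun i j : Fin 2 => if i.val + j.val + 1 = 2 then (1 : L) else 0)).toAdelic γH.1),
            (UnitaryGroup.cmDatum L 1 (Matrix.of fun i j : Fin 1 => if i.val + j.val + 1 = 1 then (1 : L) else 0)).toLocal v ((UnitaryGroup.cmDatum L 1 (Matrix.of fun i j : Fin 1 => if i.val + j.val + 1 = 1 then (1 : L) else 0)).toAdelic γH.2)),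
            stableOrbitalIntegralRel (IsLocalStablyConjH L v) mHv fH γ =
              ∑ᶠ x : ConjClasses ((UnitaryGroup.cmDatum L 3 H').Local v), Δv.Δ γ (Quotient.out x) * classOrbitalIntegral mGv f x) ∧
          Δv.Δ ((UnitaryGroup.cmDatum L 2 (Matrix.of fun i j : Fin 2 => if i.val + j.val + 1 = 2 then (1 : L) else 0)).toLocal v ((UnitaryGroup.cmDatum L 2 (Matrix.of fun i j : Fin 2 => if i.val + j.val + 1 = 2 then (1 : L) else 0)).toAdelic γH.1),
            (UnitaryGroup.cmDatum L 1 (Matrix.of fun i j : Fin 1 => if i.val + j.val + 1 = 1 then (1 : L) else 0)).toLocal v ((UnitaryGroup.cmDatum L 1 (Matrix.of fun i j : Fin 1 => if i.val + j.val + 1 = 1 then (1 : L) else 0)).toAdelic γH.2)) ((UnitaryGroup.cmDatum L 3 H').toLocal v ((UnitaryGroup.cmDatum L 3 H').toAdelic γ₀)) *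
              localStableOrbitalIntegral L 3 H' v mGs₀v f ((UnitaryGroup.cmDatum L 3 H').toLocal v ((UnitaryGroup.cmDatum L 3 H').toAdelic γ₀)) =
            (c : ℂ) * fH ((UnitaryGroup.cmDatum L 2 (Matrix.of fun i j : Fin 2 => if i.val + j.val + 1 = 2 then (1 : L) else 0)).toLocal v ((UnitaryGroup.cmDatum L 2 (Matrix.of fun i j : Fin 2 => if i.val + j.val + 1 = 2 then (1 : L) else 0)).toAdelic γH.1),
            (UnitaryGroup.cmDatum L 1 (Matrix.of fun i j : Fin 1 => if i.val + j.val + 1 = 1 then (1 : L) else 0)).toLocal v ((UnitaryGroup.cmDatum L 1 (Matrix.of fun i j : Fin 1 => if i.val + j.val + 1 = 1 then (1 : L) else 0)).toAdelic γH.2)) := by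

  intro L _ _ _ H' hherm hanis v iH bH iHQ bHQ iG bG iGQ bGQ νHv νGv iνH1 iνH2 iνG1 iνG2 Δv mHv mGv hLTD hmH hmG hv μ hμu hμω hΔv mGs₀v hquot
    γ₀ e₁ e₂ hne hprod hnsc hchar γH hγ1 hγ2
  classical
  subst hΔv
  /- (0) the place above `v`, `det H′ ≠ 0` -/
  obtain ⟨w⟩ := (inferInstance : Nonempty (UnitaryGroup.PlacesOver L v))
  have hw : IsCMField.complexConj L • w.1 = w.1 := smul_eq_of_subsingleton_placesOver L hv w
  have hdet' : H'.det ≠ 0 := Godement.det_ne_zero_of_anisotropic L H' hanis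
  /- (B) THE LOCAL→GLOBAL BRIDGE: all σ-algebras are Borel; `νHv`, `νGv` become the `v`-components of global Haar families -/
  have eH : iH = borel _ := BorelSpace.measurable_eq
  subst eH
  have eG : iG = borel _ := BorelSpace.measurable_eq
  subst eG
  letI IH : ∀ v' : HeightOneSpectrum (𝓞 ↥(maximalRealSubfield L)),
      MeasurableSpace ((UnitaryGroup.cmDatum L 2 (Matrix.of fun i j : Fin 2 => if i.val + j.val + 1 = 2 then (1 : L) else 0)).Local v' × (UnitaryGroup.cmDatum L 1 (Matrix.of fun i j : Fin 1 => if i.val + j.val + 1 = 1 then (1 : L) else 0)).Local v') := fun _ => borel _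
  haveI BH : ∀ v' : HeightOneSpectrum (𝓞 ↥(maximalRealSubfield L)),
      BorelSpace ((UnitaryGroup.cmDatum L 2 (Matrix.of fun i j : Fin 2 => if i.val + j.val + 1 = 2 then (1 : L) else 0)).Local v' × (UnitaryGroup.cmDatum L 1 (Matrix.of fun i j : Fin 1 => if i.val + j.val + 1 = 1 then (1 : L) else 0)).Local v') := fun _ => ⟨rfl⟩
  letI IG : ∀ v' : HeightOneSpectrum (𝓞 ↥(maximalRealSubfield L)), MeasurableSpace ((UnitaryGroup.cmDatum L 3 H').Local v') := fun _ => borel _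
  haveI BG : ∀ v' : HeightOneSpectrum (𝓞 ↥(maximalRealSubfield L)), BorelSpace ((UnitaryGroup.cmDatum L 3 H').Local v') := fun _ => ⟨rfl⟩
  -- `νHv` is a Haar measure: an admissible canonical family has `νHv ≠ 0`; `H_v` is unimodular
  haveI iνH0 : νHv.IsHaarMeasure := by
    have hneH : νHv ≠ 0 := by
      intro hv0
      obtain ⟨γH', -, hreg', -⟩ := K2E4WeakMatrixAlmostEverywhereAgreement.exists_isGRegular_isNormPair (L := L) H' hherm hanis
      have hP := isLocalGRegular_out_mk_rationalComponent L γH' hreg' v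
      obtain ⟨t₀, ht₀, hti₀, -, hm⟩ := hmH _ hP
      have hz := (hLTD.2.1 _ hP).1
      rw [hm] at hz
      exact hz (quotientMeasure_eq_zero_of_eq_zero _ _ t₀ νHv hv0)
    haveI := K2E4WeakMatrixAlmostEverywhereAgreement.isMulRightInvariant_endoscopicLocal L v (MeasureTheory.Measure.haar : Measure ((UnitaryGroup.cmDatum L 2 (Matrix.of fun i j : Fin 2 => if i.val + j.val + 1 = 2 then (1 : L) else 0)).Local v × (UnitaryGroup.cmDatum L 1 (Matrix.of fun i j : Fin 1 => if i.val + j.val + 1 = 1 then (1 : L) else 0)).Local v))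
    exact isHaarMeasure_of_isMulRightInvariant_of_ne_zero MeasureTheory.Measure.haar νHv hneH
  obtain ⟨νH, hνHv, hνH1, hνH2⟩ : ∃ νH : (∀ v' : HeightOneSpectrum (𝓞 ↥(maximalRealSubfield L)),
      Measure ((UnitaryGroup.cmDatum L 2 (Matrix.of fun i j : Fin 2 => if i.val + j.val + 1 = 2 then (1 : L) else 0)).Local v' × (UnitaryGroup.cmDatum L 1 (Matrix.of fun i j : Fin 1 => if i.val + j.val + 1 = 1 then (1 : L) else 0)).Local v')),
      νH v = νHv ∧ (∀ v', (νH v').IsHaarMeasure) ∧ (∀ v', (νH v').IsMulRightInvariant) := by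
    refine ⟨Function.update (fun v' => MeasureTheory.Measure.haar) v νHv, by rw [Function.update_self], fun v' => ?_, fun v' => ?_⟩
    · by_cases h : v' = v
      · subst h; rw [Function.update_self]; infer_instance
      · rw [Function.update_of_ne h]; infer_instance
    · by_cases h : v' = v
      · subst h; rw [Function.update_self]; infer_instance
      · rw [Function.update_of_ne h]; exact isMulRightInvariant_localEndoscopic L v' _
  obtain ⟨νG, hνGv, hνG1, hνG2⟩ : ∃ νG : (∀ v' : HeightOneSpectrum (𝓞 ↥(maximalRealSubfield L)), Measure ((UnitaryGroup.cmDatum L 3 H').Local v')),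
      νG v = νGv ∧ (∀ v', (νG v').IsHaarMeasure) ∧ (∀ v', (νG v').IsMulRightInvariant) := by
    refine ⟨Function.update (fun v' => MeasureTheory.Measure.haar) v νGv, by rw [Function.update_self], fun v' => ?_, fun v' => ?_⟩
    · by_cases h : v' = v
      · subst h; rw [Function.update_self]; infer_instance
      · rw [Function.update_of_ne h]; infer_instance
    · by_cases h : v' = v
      · subst h; rw [Function.update_self]; infer_instance
      · rw [Function.update_of_ne h]; exact isMulRightInvariant_cmDatum_local_three L H' hherm hdet' v' _
  subst hνHv hνGv
  haveI := hνH1; haveI := hνH2; haveI := hνG1; haveI := hνG2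
  have hHd : IsUnit ((UnitaryGroup.adelicForm L 3 H').map (UnitaryGroup.adeleToLocal L v)).det := UnitaryGroup.isUnit_det_localForm L 3 H' v hdet'
  have hH := UnitaryGroup.map_conjLocal_transpose_localForm L 3 H' v hherm
  /- (1) the `H`-centre `ε_H = ((γ_H.1)_v, (γ_H.2)_v)`, `ε_H.1 = a • 1` with `a = e₁ ⊗ 1`, `u = e₂ ⊗ 1 ≠ a` -/
  set εH : ((UnitaryGroup.cmDatum L 2 (Matrix.of fun i j : Fin 2 => if i.val + j.val + 1 = 2 then (1 : L) else 0)).Local v × (UnitaryGroup.cmDatum L 1 (Matrix.of fun i j : Fin 1 => if i.val + j.val + 1 = 1 then (1 : L) else 0)).Local v) :=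
    ((UnitaryGroup.cmDatum L 2 (Matrix.of fun i j : Fin 2 => if i.val + j.val + 1 = 2 then (1 : L) else 0)).toLocal v ((UnitaryGroup.cmDatum L 2 (Matrix.of fun i j : Fin 2 => if i.val + j.val + 1 = 2 then (1 : L) else 0)).toAdelic γH.1),
      (UnitaryGroup.cmDatum L 1 (Matrix.of fun i j : Fin 1 => if i.val + j.val + 1 = 1 then (1 : L) else 0)).toLocal v ((UnitaryGroup.cmDatum L 1 (Matrix.of fun i j : Fin 1 => if i.val + j.val + 1 = 1 then (1 : L) else 0)).toAdelic γH.2)) with hεHdef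
  set γ₀v : ((UnitaryGroup.cmDatum L 3 H').Local v) := (UnitaryGroup.cmDatum L 3 H').toLocal v ((UnitaryGroup.cmDatum L 3 H').toAdelic γ₀) with hγ₀vdef
  set a : UnitaryGroup.LocalRing L v := UnitaryGroup.adeleToLocal L v (algebraMap L (AdeleRing (𝓞 L) L) e₁) with hadef
  have ha : (εH.1.val.val : Matrix (Fin 2) (Fin 2) (UnitaryGroup.LocalRing L v)) = a • (1 : Matrix (Fin 2) (Fin 2) (UnitaryGroup.LocalRing L v)) :=
    coe_coe_cmDatum_toLocal_toAdelic_eq_smul_one_of_smul_one hγ1 v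
  have hu : (εH.2.val.val : Matrix (Fin 1) (Fin 1) (UnitaryGroup.LocalRing L v)) 0 0 ≠ a := by
    intro hua
    apply hne
    have h2 : (εH.2.val.val : Matrix (Fin 1) (Fin 1) (UnitaryGroup.LocalRing L v)) 0 0 = algebraMap L (UnitaryGroup.LocalRing L v) e₂ := by
      change ((((UnitaryGroup.cmDatum L 1 (Matrix.of fun i j : Fin 1 => if i.val + j.val + 1 = 1 then (1 : L) else 0)).toLocal v ((UnitaryGroup.cmDatum L 1 (Matrix.of fun i j : Fin 1 => if i.val + j.val + 1 = 1 then (1 : L) else 0)).toAdelic γH.2)).val :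
          GL (Fin 1) (UnitaryGroup.LocalRing L v)).val : Matrix (Fin 1) (Fin 1) (UnitaryGroup.LocalRing L v)) 0 0 = _
      rw [coe_toLocal_toAdelic_eq_map, Matrix.map_apply, hγ2]
    have h1 : a = algebraMap L (UnitaryGroup.LocalRing L v) e₁ := by
      rw [hadef, ← UnitaryGroup.adeleToLocal_comp_algebraMap (E := L) v, RingHom.comp_apply]
    rw [h2, h1] at hua
    exact ((algebraMap L (UnitaryGroup.LocalRing L v)).injective hua).symm
  have hu₀ : IsUnit ((finCharpolyTwo L v εH).eval (finGammaTwo L v εH)) := isUnit_eval_finCharpolyTwo_of_central L v w hw εH a ha hu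
  /- (2) the central dock, the bad frame, the closed orbit of the dock point -/
  obtain ⟨ε, y, θ, hmε, hθε, hθ⟩ := exists_centralDock_of_fst_eq_smul_one (L := L) (H' := H') (v := v) w hw hherm hdet' εH a ha hu
  have hy : y * ((endoEmbLocal L v εH).val : GL (Fin 3) (UnitaryGroup.LocalRing L v)) * y⁻¹ = ε.val := by rw [← hθ εH, hθε]
  set W : GL (Fin 3) (UnitaryGroup.LocalRing L v) :=
    ⟨!![(1 : UnitaryGroup.LocalRing L v), 0, 0; 0, 0, 1; 0, 1, 0], !![(1 : UnitaryGroup.LocalRing L v), 0, 0; 0, 0, 1; 0, 1, 0],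
      swap_mul_swap_eq_one, swap_mul_swap_eq_one⟩ with hWdef
  have hW : W.val = !![(1 : UnitaryGroup.LocalRing L v), 0, 0; 0, 0, 1; 0, 1, 0] := rfl
  obtain ⟨G₁, G₂, P', G₁', G₂', hPW, hP', hnn⟩ := exists_badFrame_dock (L := L) (H' := H') (v := v) w hw hherm hdet' εH a ha hu hy hW
  have hau : IsUnit (a - (εH.2.val.val : Matrix (Fin 1) (Fin 1) (UnitaryGroup.LocalRing L v)) 0 0) :=
    isUnit_localRing_of_ne_zero_of_subsingleton L v hv (sub_ne_zero.2 (Ne.symm hu))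
  have hι : (((endoEmbLocal L v εH).val : GL (Fin 3) (UnitaryGroup.LocalRing L v)).val - a • (1 : Matrix (Fin 3) (Fin 3) (UnitaryGroup.LocalRing L v))) *
      (((endoEmbLocal L v εH).val : GL (Fin 3) (UnitaryGroup.LocalRing L v)).val - ((εH.2.val.val : Matrix (Fin 1) (Fin 1) (UnitaryGroup.LocalRing L v)) 0 0) • (1 : Matrix (Fin 3) (Fin 3) (UnitaryGroup.LocalRing L v))) = 0 := by
    rw [show ((endoEmbLocal L v εH).val : GL (Fin 3) (UnitaryGroup.LocalRing L v)).val = !![a, 0, 0; 0, (εH.2.val.val : Matrix (Fin 1) (Fin 1) (UnitaryGroup.LocalRing L v)) 0 0, 0; 0, 0, a]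
      from coe_coe_endoEmbLocal_of_fst_eq_smul_one L v εH a ha]
    exact diag_sub_smul_mul_sub_smul_eq_zero _ _
  have hεann := mul_sub_smul_eq_zero_of_isConj_val L 3 v ⟨y, hy⟩ hau hι
  have hεO : IsClosed {g : ((UnitaryGroup.cmDatum L 3 H').Local v) | ∃ x : ((UnitaryGroup.cmDatum L 3 H').Local v), x * ε * x⁻¹ = g} :=
    isClosed_conjClass_local_of_mul_sub_smul_eq_zero L 3 H' v hherm hdet' ε hau hεann
  /- (3) the singular guard: `(γ_H)_v → (γ₀)_v` (★ `singularPairIsLocalNormPair`), so every match of `ε_H` is guarded by `γ₀` -/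
  have hnreg : ¬ IsRegularElt ((γ₀ : unitaryGroup (cmConjRingHom L) H').val : GL (Fin 3) L) := not_isRegularElt_of_charpoly_eq_sq_mul _ e₁ e₂ hchar
  have hmγ₀ : IsLocalNormPair L H' v εH γ₀v := K2E4SingularPairIsLocalNormPair.singularPairIsLocalNormPair L H' γ₀ e₁ e₂ hne hprod hchar γH hγ1 hγ2 v
  have hguard : ∀ x : ((UnitaryGroup.cmDatum L 3 H').Local v), IsLocalNormPair L H' v εH x → ∃ γ₁ : (UnitaryGroup.cmDatum L 3 H').Rational, ¬ IsRegularElt (γ₁.val : GL (Fin 3) L) ∧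
      Corresponds (UnitaryGroup.conjLocal L (IsCMField.complexConj L) v) ((UnitaryGroup.adelicForm L 3 H').map (UnitaryGroup.adeleToLocal L v))
        ((UnitaryGroup.adelicForm L 3 H').map (UnitaryGroup.adeleToLocal L v)) ((UnitaryGroup.cmDatum L 3 H').toLocal v ((UnitaryGroup.cmDatum L 3 H').toAdelic γ₁)) x :=
    fun x hx => ⟨γ₀, hnreg, (IsConj.symm hmγ₀).trans hx⟩
  obtain ⟨hTε, hTiε⟩ := isHaarMeasure_isInvInvariant_finTamagawaPartner_of_guard L H' hherm hanis v ε (hguard ε hmε)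
  /- (4) the dock scalar `aθ` (P1) and the Euler–Poincaré datum of ‹J3› -/
  obtain ⟨aθ, haθpos, haθ⟩ := exists_pos_map_dock_eq_smul_finTamagawaPartner L H' hherm hanis v (νH v) ε (hguard ε hmε) θ
  letI iU₂ : MeasurableSpace ((UnitaryGroup.cmDatum L 2 (Matrix.of fun i j : Fin 2 => if i.val + j.val + 1 = 2 then (1 : L) else 0)).Local v) := borel _
  haveI bU₂ : BorelSpace ((UnitaryGroup.cmDatum L 2 (Matrix.of fun i j : Fin 2 => if i.val + j.val + 1 = 2 then (1 : L) else 0)).Local v) := ⟨rfl⟩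
  letI iZ₂ : ∀ γ : ((UnitaryGroup.cmDatum L 2 (Matrix.of fun i j : Fin 2 => if i.val + j.val + 1 = 2 then (1 : L) else 0)).Local v), MeasurableSpace (((UnitaryGroup.cmDatum L 2 (Matrix.of fun i j : Fin 2 => if i.val + j.val + 1 = 2 then (1 : L) else 0)).Local v) ⧸ Subgroup.centralizer ({γ} : Set ((UnitaryGroup.cmDatum L 2 (Matrix.of fun i j : Fin 2 => if i.val + j.val + 1 = 2 then (1 : L) else 0)).Local v))) := fun _ => borel _
  haveI bZ₂ : ∀ γ : ((UnitaryGroup.cmDatum L 2 (Matrix.of fun i j : Fin 2 => if i.val + j.val + 1 = 2 then (1 : L) else 0)).Local v), BorelSpace (((UnitaryGroup.cmDatum L 2 (Matrix.of fun i j : Fin 2 => if i.val + j.val + 1 = 2 then (1 : L) else 0)).Local v) ⧸ Subgroup.centralizer ({γ} : Set ((UnitaryGroup.cmDatum L 2 (Matrix.of fun i j : Fin 2 => if i.val + j.val + 1 = 2 then (1 : L) else 0)).Local v))) := fun _ => ⟨rfl⟩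
  haveI : CompactSpace ((UnitaryGroup.cmDatum L 1 (Matrix.of fun i j : Fin 1 => if i.val + j.val + 1 = 1 then (1 : L) else 0)).Local v) := compactSpace_cmDatum_local_one_of_smul_eq L v w hw
  obtain ⟨hν₂H, hν₂R⟩ := isHaarMeasure_map_fst_of_compactSpace L v (νH v)
  haveI := hν₂H
  haveI := hν₂R
  obtain ⟨-, m₂, hm₂⟩ := exists_isCanonical_cmDatum_local_two L v (Measure.map (Prod.fst : ((UnitaryGroup.cmDatum L 2 (Matrix.of fun i j : Fin 2 => if i.val + j.val + 1 = 2 then (1 : L) else 0)).Local v × (UnitaryGroup.cmDatum L 1 (Matrix.of fun i j : Fin 1 => if i.val + j.val + 1 = 1 then (1 : L) else 0)).Local v) → ((UnitaryGroup.cmDatum L 2 (Matrix.of fun i j : Fin 2 => if i.val + j.val + 1 = 2 then (1 : L) else 0)).Local v)) (νH v))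
  obtain ⟨f₂, r, hf₂, hf1, hf0, hfval, hJ⟩ := hJ3 L H' μ νH νG hμu hμω hherm hanis v hv mHv mGv hmH hmG εH a ha hu ε y θ hθε hθ W hW
    G₁ G₁' G₂ G₂' P' hPW hP' hnn hεO (Measure.map (Prod.fst : ((UnitaryGroup.cmDatum L 2 (Matrix.of fun i j : Fin 2 => if i.val + j.val + 1 = 2 then (1 : L) else 0)).Local v × (UnitaryGroup.cmDatum L 1 (Matrix.of fun i j : Fin 1 => if i.val + j.val + 1 = 1 then (1 : L) else 0)).Local v) → ((UnitaryGroup.cmDatum L 2 (Matrix.of fun i j : Fin 2 => if i.val + j.val + 1 = 2 then (1 : L) else 0)).Local v)) (νH v)) m₂ rfl hm₂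
  -- the transported Haar measure `θ_* ν_H` on `Z(ε)` (instances for (α)'s value clause)
  haveI : LocallyCompactSpace ↥(Subgroup.centralizer ({ε} : Set ((UnitaryGroup.cmDatum L 3 H').Local v))) := (isClosed_coe_centralizer_singleton ε).isClosedEmbedding_subtypeVal.locallyCompactSpace
  haveI hM1 : (Measure.map (⇑θ) (νH v)).IsHaarMeasure := MulEquiv.isHaarMeasure_map (νH v) θ.toMulEquiv θ.continuous θ.symm.continuous
  haveI hM2 : (Measure.map (⇑θ) (νH v)).IsMulRightInvariant := isMulRightInvariant_map_mulEquiv_of_isMulRightInvariant θ.toMulEquiv θ.continuous.measurable (νH v)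
  haveI hM3 : (Measure.map (⇑θ) (νH v)).IsInvInvariant :=
    isInvInvariant_of_isMulRightInvariant_of_isClosed (Subgroup.centralizer ({ε} : Set ((UnitaryGroup.cmDatum L 3 H').Local v))) (isClosed_coe_centralizer_singleton ε) (Measure.map (⇑θ) (νH v))
  -- one second class `ε′₀` (from (α) at `φ = 0`) to read the sign law
  obtain ⟨ε'₀, hε'₀P, hmatch₀, -⟩ := exists_nhds_local_transfer_and_apply_centre_of_EP L H' μ νH νG hμu hμω hherm hanis v hv mHv mGv hmH hmG _ isLocSmooth_zero
    εH a ha hu ε y θ hθε hθ W hW G₁ G₁' G₂ G₂' P' hPW hP' hnn hεO (Measure.map (Prod.fst : ((UnitaryGroup.cmDatum L 2 (Matrix.of fun i j : Fin 2 => if i.val + j.val + 1 = 2 then (1 : L) else 0)).Local v × (UnitaryGroup.cmDatum L 1 (Matrix.of fun i j : Fin 1 => if i.val + j.val + 1 = 1 then (1 : L) else 0)).Local v) → ((UnitaryGroup.cmDatum L 2 (Matrix.of fun i j : Fin 2 => if i.val + j.val + 1 = 2 then (1 : L) else 0)).Local v)) (νH v)) m₂ rfl hm₂ f₂ r hf₂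 hf1 hf0 hfval
  /- (5) THE CONSTANT `c = ± aθ` -/
  refine ⟨if IsConj ε γ₀v then (aθ : ℝ) else -(aθ : ℝ), ?_, ?_, ?_⟩
  · split_ifs
    · exact (NNReal.coe_pos.2 haθpos).ne'
    · exact neg_ne_zero.2 (NNReal.coe_pos.2 haθpos).ne'
  · -- the sign law: `c < 0 ↔ (γ₀)_v ≁ ε ↔ e_v(⟦(γ₀)_v⟧) = −1 ↔ the e₁-eigenplane of (γ₀)_v is anisotropic`
    rw [K2E4SingularPairEigenplane.aniso_local_iff_kottwitzSignLocal_eq_neg_one L H' hherm hanis γ₀ e₁ e₂ hne hprod hchar v,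
      K2E3RoadJScalarPartnerClasses.kottwitzSignLocal_eq_neg_one_iff_not_isConj_dock L H' hherm hanis v hv εH a ha hu ε y θ hθε hθ W hW G₁ G₁' G₂ G₂' P' hPW hP' hnn
        ε'₀ hε'₀P hmε hmatch₀ γ₀v hmγ₀]
    split_ifs with hc
    · simp only [hc, not_true_eq_false, iff_false, not_lt]
      exact aθ.coe_nonneg
    · simp only [hc, not_false_eq_true, iff_true, neg_lt_zero]
      exact NNReal.coe_pos.2 haθpos
  /- (6) per test function: (α), then the algebra of (b2)–(b6) -/
  intro f hf
  obtain ⟨ε', hε'P, hmatch, V, hV, φH, hφH, hid, hval⟩ := exists_nhds_local_transfer_and_apply_centre_of_EP L H' μ νH νG hμu hμω hherm hanis v hv mHv mGv hmH hmG f hf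
    εH a ha hu ε y θ hθε hθ W hW G₁ G₁' G₂ G₂' P' hPW hP' hnn hεO (Measure.map (Prod.fst : ((UnitaryGroup.cmDatum L 2 (Matrix.of fun i j : Fin 2 => if i.val + j.val + 1 = 2 then (1 : L) else 0)).Local v × (UnitaryGroup.cmDatum L 1 (Matrix.of fun i j : Fin 1 => if i.val + j.val + 1 = 1 then (1 : L) else 0)).Local v) → ((UnitaryGroup.cmDatum L 2 (Matrix.of fun i j : Fin 2 => if i.val + j.val + 1 = 2 then (1 : L) else 0)).Local v)) (νH v)) m₂ rfl hm₂ f₂ r hf₂ hf1 hf0 hfval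
  refine ⟨φH, hφH, Filter.mem_of_superset (inter_mem_nhdsWithin _ hV) fun γ hγ => hid γ hγ.2 hγ.1, ?_⟩
  -- the guard at `ε′`, compactness of `Z(ε′)`, the partner `t^ω(ε′)` Haar
  obtain ⟨hTε', hTiε'⟩ := isHaarMeasure_isInvInvariant_finTamagawaPartner_of_guard L H' hherm hanis v ε' (hguard ε' hmatch)
  haveI := K2E3RoadJScalarPartnerClasses.compactSpace_centralizer_secondClass L H' hherm hanis v hv εH a hu ε y θ hθ W hW G₁ G₁' G₂ G₂' P' hPW hP' hnn ε' hε'P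
  -- the value of (α) against `θ_* ν_H`, the three orbital readings (P2)(P3)(P4), the flip (b2), J3, the two-class sum (A7)
  have hvalue := hval (Measure.map (⇑θ) (νH v)) rfl
  have hP2 := orbitalIntegral_quotientMeasure_eq_inv_mul_of_eq_smul (νG v) ε (Literature.NumberTheory.Weil1982.UnitaryFinTopForm.finTamagawaPartner L 3 H' v ε)
    (Measure.map (⇑θ) (νH v)) haθpos.ne' haθ f
  have hP3ε := classOrbitalIntegral_mk_eq_orbitalIntegral_of_isQuotientOf_finTamagawaPartner L H' hherm hanis v (νG v) hquot ε (hguard ε hmε) f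
    (Literature.NumberTheory.Weil1982.UnitaryFinTopForm.finTamagawaPartner L 3 H' v ε) rfl
  have hP3ε' := classOrbitalIntegral_mk_eq_orbitalIntegral_of_isQuotientOf_finTamagawaPartner L H' hherm hanis v (νG v) hquot ε' (hguard ε' hmatch) f
    (Literature.NumberTheory.Weil1982.UnitaryFinTopForm.finTamagawaPartner L 3 H' v ε') rfl
  have hP4 := integral_conj_eq_measureReal_mul_orbitalIntegral_local L H' v (νG v) ε' (Literature.NumberTheory.Weil1982.UnitaryFinTopForm.finTamagawaPartner L 3 H' v ε') f hf
  have hJ3' := hJ ε' hε'P hmatch aθ haθ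
  have hεε' : ¬ IsConj (⟨ε.val, ε.2⟩ : unitaryGroup (UnitaryGroup.conjLocal L (IsCMField.complexConj L) v) ((UnitaryGroup.adelicForm L 3 H').map (UnitaryGroup.adeleToLocal L v))) ⟨ε'.val, ε'.2⟩ :=
    K2E3RoadJScalarPartnerClasses.not_isConj_dock_secondClass L H' hherm hanis v hv εH a ha hu ε y θ hθε hθ W hW G₁ G₁' G₂ G₂' P' hPW hP' hnn ε' hε'P
  have hflip : finExplicitDelta L v H' εH μ ε' = -finExplicitDelta L v H' εH μ ε :=
    finExplicitDelta_eq_neg_of_not_isConj_of_fst_eq_smul_one L v H' εH ε ε' μ w hw hmε hmatch hu₀ hH hHd ha hεε'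
  have hSO := K2E3RoadJScalarPartnerClasses.localStableOrbitalIntegral_eq_add L H' hherm hanis v hv εH a ha hu ε y θ hθε hθ W hW G₁ G₁' G₂ G₂' P' hPW hP' hnn ε' hε'P
    hmε hmatch γ₀v hmγ₀ mGs₀v f
  -- `Δ‴((γ_H)_v, (γ₀)_v) = ± Δ‴(ε_H, ε)` according to the class of `(γ₀)_v`
  have hΔγ₀ : finExplicitDelta L v H' εH μ γ₀v = (if IsConj ε γ₀v then 1 else -1) * finExplicitDelta L v H' εH μ ε := by
    split_ifs with hc
    · obtain ⟨g, hg⟩ := isConj_iff.1 hc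
      rw [← hg, finExplicitDelta_conj_right_all L H' μ v εH ε g, one_mul]
    · rcases K2E3RoadJScalarPartnerClasses.isConj_dock_or_isConj_secondClass L H' hherm hanis v hv εH a ha hu ε y θ hθε hθ W hW G₁ G₁' G₂ G₂' P' hPW hP' hnn
          ε' hε'P hmε hmatch γ₀v hmγ₀ with h | h
      · exact absurd h hc
      · obtain ⟨g, hg⟩ := isConj_iff.1 h
        rw [← hg, finExplicitDelta_conj_right_all L H' μ v εH ε' g, hflip, neg_one_mul]
  -- assemble
  rw [hSO, finExplicitCollection_Δ, hΔγ₀, hvalue, hP2, ← hP3ε, hP4, ← hP3ε', hflip]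
  have hr : (r : ℂ) * (aθ : ℝ) * ((Literature.NumberTheory.Weil1982.UnitaryFinTopForm.finTamagawaPartner L 3 H' v ε').real Set.univ : ℝ) = 1 := by
    rw [measureReal_def]; exact_mod_cast hJ3'
  have haθ0 : ((aθ : ℝ) : ℂ) ≠ 0 := by exact_mod_cast haθpos.ne'
  split_ifs with hc
  · push_cast
    field_simp
    linear_combination (-(finExplicitDelta L v H' εH μ ε * classOrbitalIntegral mGs₀v f (ConjClasses.mk ε'))) * hr
  · push_cast
    field_simp
    linear_combination (finExplicitDelta L v H' εH μ ε * classOrbitalIntegral mGs₀v f (ConjClasses.mk ε')) * hr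

end Summit.HodgeConjecture.HodgeConjecture.Cruxes.H413.K2E3SingularTransferLocalGermValueOfRoadJ

end
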